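/-
HONEST FRAMING: certified error envelopes and provably optimal rounding/accumulation schemes for
low-precision formats under stated cost models; every table by two implementations; no hardware
or vendor claims.
-/
import Summits.Ventures.CertifiedArithmetic.LowPrec.OptDemotionRoutingR33

/-!
# The demotion law (Theorem T8), part 10j-c: the two-bit `E`-rows at `ρ = u`, every level, every tree (R34, popcount 2)

By value, in the budget units of parts 9d/10e: for every `q ≥ 4`, every level `β = 2^k`
(`k + 2 ≤ q`), every two-bit offset `B = 2^i + 2^i' < β` (`i' < i < k`) and every summation tree,
the e-side row of opt's split of the two-tree inequality

  `E(β, B, ρ = u):  2 BR_t(β + B) ≤ (1 - u) BR_t(2β + B) + (1 + u) BR_t(B + ½)`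

holds (`eRow_twoBit`) — opt gen 15 §5b R34 for `popcount(B) = 2`: R33 of part 10j-b
(`treeBR_eRow2`, every `q`) at `j = k+1-i`, `k' = k+1-i'`, scaled up by homogeneity (part 8j) and
raised in its last coordinate by one (M) step (`BR_t(B + 2β u) ≤ BR_t(B + ½)`), exactly as part 10c
`treeBRv_eRow_singleBit` does for R31.  With parts 10c/10e (`eRow_zero_u`, `eRow_singleBit`):
EVERY e-side row with `popcount(B) ≤ 2` holds at `ρ = u` at every level, for every tree and
every `q` — no certificate needed for these rows in `TTlow_of_rows` / `ttCheckLow`.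
-/

namespace Summit.Ventures.CertifiedArithmetic.LowPrec.Opt

open Literature.ComputerArithmetic.JeannerodRump2018
open Literature.ComputerArithmetic.JeannerodRump2018.SumTree

section R33Rows

variable {q : ℕ}

/-- `val {a, b, c} = 2^a + 2^b + 2^c` for distinct exponents. -/
theorem val_triple {a b c : ℤ} (hab : a ≠ b) (hac : a ≠ c) (hbc : b ≠ c) :
    val ({a, b, c} : Finset ℤ) = (2 : ℚ) ^ a + (2 : ℚ) ^ b + (2 : ℚ) ^ c := by
  rw [val_insert (by simp only [Finset.mem_insert, Finset.mem_singleton]; omega), val_pair hbc]; ring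

/-- The image of a three-bit configuration under a shift. -/
theorem image_triple_add (a b c k : ℤ) :
    (({a, b, c} : Finset ℤ).image fun e => e + k) = ({a + k, b + k, c + k} : Finset ℤ) := by
  simp only [Finset.image_insert, Finset.image_singleton]

/-- **THE TWO-BIT `E`-ROWS AT `ρ = u`, EVERY LEVEL, EVERY TREE, EVERY `q ≥ 4`** (opt R34 for
popcount 2, by R33 + homogeneity + (M)): with `β = 2^k` (`k + 2 ≤ q`), `B = 2^i + 2^i'`
(`i' < i < k`) and `e = β + B`: `2 BR_t(e) ≤ (1 - u) BR_t(e + β) + (1 + u) BR_t(e - β + ½)`. -/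
theorem treeBRv_eRow_twoBit (hq : 4 ≤ q) {k i i' : ℕ} (hk : k + 2 ≤ q) (hik : i < k) (hii : i' < i)
    (t : SumTree) :
    let β : ℚ := (2 : ℚ) ^ k
    let e : ℚ := β + ((2 ^ i + 2 ^ i' : ℕ) : ℚ)
    2 * treeBRv q t e ≤ (1 - unitRoundoff q) * treeBRv q t (e + β) +
      (1 + unitRoundoff q) * treeBRv q t (e - β + 1 / 2) := by
  intro β e
  have hq1 : 1 ≤ q := by omega
  -- R33 at j = k + 1 - i, k' = k + 1 - i'
  obtain ⟨j, hj⟩ : ∃ j : ℕ, j = k + 1 - i := ⟨_, rfl⟩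
  obtain ⟨k', hk'⟩ : ∃ k' : ℕ, k' = k + 1 - i' := ⟨_, rfl⟩
  have hj2 : 2 ≤ j := by omega
  have hjk : j < k' := by omega
  have hkq : k' + 1 ≤ q := by omega
  have hjz : (j : ℤ) = (k : ℤ) + 1 - i := by omega
  have hkz : (k' : ℤ) = (k : ℤ) + 1 - i' := by omega
  have h := treeBR_eRow2 hq hj2 hjk hkq t
  -- shifts
  have s1 := treeBR_image_add (q := q) t ({0, -((j : ℤ) - 1), -((k' : ℤ) - 1)} : Finset ℤ) (k : ℤ)
  have s2 := treeBR_image_add (q := q) t ({0, -(j : ℤ), -(k' : ℤ)} : Finset ℤ) ((k : ℤ) + 1)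
  have s3 := treeBR_image_add (q := q) t ({0, -((k' : ℤ) - j), -((q : ℤ) - j)} : Finset ℤ) ((k : ℤ) + 1 - j)
  rw [image_triple_add] at s1 s2 s3
  have i1 : ({0 + (k : ℤ), -((j : ℤ) - 1) + (k : ℤ), -((k' : ℤ) - 1) + (k : ℤ)} : Finset ℤ) =
      {(k : ℤ), (i : ℤ), (i' : ℤ)} := by
    rw [hjz, hkz]; ext z; simp only [Finset.mem_insert, Finset.mem_singleton]; omega
  have i2 : ({0 + ((k : ℤ) + 1), -(j : ℤ) + ((k : ℤ) + 1), -(k' : ℤ) + ((k : ℤ) + 1)} : Finset ℤ) =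
      {(k : ℤ) + 1, (i : ℤ), (i' : ℤ)} := by
    rw [hjz, hkz]; ext z; simp only [Finset.mem_insert, Finset.mem_singleton]; omega
  have i3 : ({0 + ((k : ℤ) + 1 - j), -((k' : ℤ) - j) + ((k : ℤ) + 1 - j), -((q : ℤ) - j) + ((k : ℤ) + 1 - j)} : Finset ℤ) =
      {(i : ℤ), (i' : ℤ), (k : ℤ) + 1 - q} := by
    rw [hjz, hkz]; ext z; simp only [Finset.mem_insert, Finset.mem_singleton]; omega
  rw [i1] at s1
  rw [i2] at s2
  rw [i3] at s3
  -- (M): BR{i, i', k+1-q} ≤ BR{i, i', -1}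
  have hM : treeBR q t {(i : ℤ), (i' : ℤ), (k : ℤ) + 1 - q} ≤ treeBR q t {(i : ℤ), (i' : ℤ), -1} := by
    refine treeBR_mono hq1 t (Finset.insert_nonempty _ _) (Finset.insert_nonempty _ _) ?_ ?_ ?_
    · intro a ha b hb
      simp only [Finset.mem_insert, Finset.mem_singleton] at ha hb
      rcases ha with rfl | rfl | rfl <;> rcases hb with rfl | rfl | rfl <;> omega
    · intro a ha b hb
      simp only [Finset.mem_insert, Finset.mem_singleton] at ha hb
      rcases ha with rfl | rfl | rfl <;> rcases hb with rfl | rfl | rfl <;> omega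
    · rw [val_triple (by omega) (by omega) (by omega), val_triple (by omega) (by omega) (by omega)]
      have : (2 : ℚ) ^ ((k : ℤ) + 1 - q) ≤ (2 : ℚ) ^ (-1 : ℤ) :=
        zpow_le_zpow_right₀ (by norm_num) (by omega)
      linarith
  -- the three values
  have hβ : β = (2 : ℚ) ^ (k : ℤ) := (zpow_natCast 2 k).symm
  have hB : ((2 ^ i + 2 ^ i' : ℕ) : ℚ) = (2 : ℚ) ^ (i : ℤ) + (2 : ℚ) ^ (i' : ℤ) := by
    push_cast; rw [← zpow_natCast 2 i, ← zpow_natCast 2 i']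
  have he : e = val ({(k : ℤ), (i : ℤ), (i' : ℤ)} : Finset ℤ) := by
    rw [val_triple (by omega) (by omega) (by omega)]; show β + _ = _; rw [hβ, hB]; ring
  have he1 : e + β = val ({(k : ℤ) + 1, (i : ℤ), (i' : ℤ)} : Finset ℤ) := by
    rw [val_triple (by omega) (by omega) (by omega), he, val_triple (by omega) (by omega) (by omega), hβ,
      zpow_add_one₀ (by norm_num : (2 : ℚ) ≠ 0)]
    ring
  have he2 : e - β + 1 / 2 = val ({(i : ℤ), (i' : ℤ), -1} : Finset ℤ) := by
    rw [val_triple (by omega) (by omega) (by omega), he, val_triple (by omega) (by omega) (by omega), hβ,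
      zpow_neg_one]
    ring
  rw [he1, he2, he, treeBRv_val, treeBRv_val, treeBRv_val, s1, s2]
  have hpos : 0 < (2 : ℚ) ^ (k : ℤ) := zpow_pos (by norm_num) _
  have hu1 : 0 ≤ 1 + unitRoundoff q := by linarith [unitRoundoff_nonneg q]
  have hu1' : 0 ≤ 1 - unitRoundoff q := by linarith [unitRoundoff_le_one q]
  have h' := mul_le_mul_of_nonneg_left h hpos.le
  have hM' := mul_le_mul_of_nonneg_left (mul_le_mul_of_nonneg_left hM hu1) hpos.le
  rw [s3] at hM'
  -- powers
  have p1 : (2 : ℚ) ^ ((k : ℤ) + 1) = 2 * (2 : ℚ) ^ (k : ℤ) := by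
    rw [zpow_add_one₀ (by norm_num)]; ring
  have p2 : (2 : ℚ) ^ ((k : ℤ) + 1 - j) = 2 * (2 : ℚ) ^ (k : ℤ) * (2 : ℚ) ^ (-(j : ℤ)) := by
    rw [← p1, ← zpow_add₀ (by norm_num)]; congr 1
  rw [p1]
  rw [p2] at hM'
  nlinarith [h', hM', hpos, mul_nonneg hu1' (treeBR_nonneg q t {0, -(j : ℤ), -(k' : ℤ)}),
    mul_nonneg hu1 (treeBR_nonneg q t {0, -((k' : ℤ) - j), -((q : ℤ) - j)})]

/-- **THE TWO-BIT ROWS `E(2^k, 2^i + 2^i', u)`**, `i' < i < k ≤ q - 2`, for every tree (R34). -/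
theorem eRow_twoBit (hq : 4 ≤ q) (t : SumTree) {k i i' : ℕ} (hk : k + 2 ≤ q) (hik : i < k) (hii : i' < i) :
    ERow q t (unitRoundoff q) k (2 ^ i + 2 ^ i') := by
  have h := treeBRv_eRow_twoBit hq hk hik hii t
  unfold ERow
  simpa using h

end R33Rows

end Summit.Ventures.CertifiedArithmetic.LowPrec.Opt
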